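import Summits.ResolutionOfSingularities.ResolutionOfSingularities.Theorems.WeightedInvariantWeightedThesisHypersurfaceChoiceDim
import Summits.ResolutionOfSingularities.ResolutionOfSingularities.Theorems.WeightedInvariantDatumToEmbeddedAtlasDefs
import HarnessLib

/-!
# Tower-typed homogeneity `(H_T)` — the choice ladder with the TOWER torus exposed (RESHAPE 10 objects)

Route `ResolutionOfSingularities/WeightedInvariant`, crux `Theses.WeightedInvariant.WeightedThesis`
(stmt-ResolutionOfSingularities-0569), line `datum-glued-split`, lead c9, RESHAPE 10 — objects.

RESHAPE 9 (`Theorems/…HypersurfaceChoice(Dim).lean`) replaced functoriality by torus-homogeneity `(H)`: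
the centre of a pair must be homogeneous for EVERY `ℤʲ`-grading of EVERY affine open of the ambient
that has the constants in degree `0` and the hypersurface ideal homogeneous — invariance under every
torus acting on a chart of the bare pair. A `T`-equivariant construction à la Abramovich–Quek–Schober
(arXiv:2507.01232, Thm. 1.1: the centre is defined through the closed ORBITS of THE torus of the tower)
is homogeneous for the tower torus, not necessarily for an exotic torus of some small affine open. The
consumer (`HypersurfaceChoiceDimTower.hasResolution_quotient_of_gradedAtlas`) reads `(H)` only on the
charts of its graded atlases, and their gradings ARE the tower torus: on the cobordant blow-up `B₊` of
the centre of `(Y, X)`, the chart `W' = D(β t^{Dg}) ∩ π₊⁻¹(U)` over a chart `U` of `Y` carries the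
`ℤʲ × ℤ`-grading of `L = (⊕ₙ 𝒥ₙ(U) tⁿ)[1/β t^{Dg}]` — the old `ℤʲ`-degree on `Γ(Y, U)` and the
`t`-degree of the extended Rees algebra `⊕ₙ 𝒥ₙ(U) tⁿ ⊆ Γ(Y, U)[t, t⁻¹]` (Włodarczyk 2022 §2.3.3; tree
`DatumToEmbedded.AtlasAmbient.exists_ambientChart`). This file NAMES that class of gradings, so that the
constructor owes homogeneity only for them:

* `TowerChartStep U j 𝒢 R' W' 𝒢'` — `(W', 𝒢')` is a TOWER CHART of `B₊ = R'.plus` over the chart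
  `(U, 𝒢)` of `Y`: `W' ≤ π₊⁻¹ U` and there is a transport `e : Γ(B₊, W') ≃+* L` into a localisation
  `L = (R'.sectionsRing U)[1/v₀]` carrying `π₊♯` to the structure map and `t⁻¹` to `t⁻¹`, and a
  `ℤʲ × ℤ`-grading `ℳ` of `L` with `t⁻¹` in degree `(0, −1)`, the old degree-`χ` sections in degree
  `(χ, 0)`, the elements `x tⁿ` (`x ∈ 𝒥ₙ(U)` of old degree `χ`) in degree `(χ, n)` — this pins `ℳ` down
  on ring generators of `L` — and `𝒢' = e⁻¹(ℳ)` re-indexed by `ℤʲ⁺¹ ≃ ℤʲ × ℤ`;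
* `HypersurfacePair.IsTowerChart c P j W 𝒢` — inductively: every affine open of every pair with the
  trivial `ℤ⁰`-grading (rank `0`), and every tower chart of the cobordant blow-up of `c P` over a tower
  chart of `P` (rank `j + 1`);
* `HypersurfaceCentreChoiceTDim p e` — the ladder `HypersurfaceCentreChoiceDim p e` with `(H)` replaced
  by `(H_T)`: homogeneity only for the tower charts of `centre` on pairs reached in transversal dimension
  `e` — exactly the gradings the route's tower confronts the constructor with;
* `HypersurfaceCentreChoiceTDim.ofChoiceDim` — `(H) ⇒ (H_T)` (tower charts have the constants in degree
  `0`, `IsTowerChart.appLE_mem`), so every rung of RESHAPE 9's ladder is a rung here;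
* `hyp_mem_of_gradedRing_fin_zero` (registered stub of the line) — a grading by the one-element group
  `ℤ⁰` is trivial (where the tower charts START).

The consumer side (the graded atlases of the tower ARE tower charts; the tower and the composition for
`(H_T)`) is `Theorems/WeightedInvariantWeightedThesisHypersurfaceChoiceT{Chart,Atlas,Tower}.lean`.
-/

noncomputable section

open scoped LaurentPolynomial
open LaurentPolynomial CategoryTheory AlgebraicGeometry TopologicalSpace
open Literature.AlgebraicGeometry.Resolution

set_option linter.dupNamespace false -- mandated namespace of this single-conjunct summit

namespace Summit.ResolutionOfSingularities.ResolutionOfSingularities.Theorems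

/-! ## A grading by the trivial group is trivial -/

/-- **A grading indexed by the one-element group `ℤ⁰ = (Fin 0 → ℤ)` is trivial** (registered stub of
line `datum-glued-split`, RESHAPE 10 — where the tower charts start): every element lies in every (i.e.
the unique) piece, because it is the sum of its homogeneous components, all indexed by the one index.
[folklore] -/
theorem hyp_mem_of_gradedRing_fin_zero : ∀ {R : Type} [CommRing R] (𝒢 : (Fin 0 → ℤ) → AddSubgroup R) [GradedRing 𝒢] (v : Fin 0 → ℤ) (x : R), x ∈ 𝒢 v := by
  intro R _ 𝒢 _ v x
  classical
  have hx : x = ∑ d ∈ (DirectSum.decompose 𝒢 x).support, (DirectSum.decompose 𝒢 x d : R) :=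
    (DirectSum.sum_support_decompose 𝒢 x).symm
  rw [hx]
  refine AddSubgroup.sum_mem _ fun d _ => ?_
  have hd : d = v := Subsingleton.elim d v
  subst hd
  exact (DirectSum.decompose 𝒢 x d).2

/-! ## Tower charts -/

/-- **One tower chart one level up.** For an affine open `U` of `Y` with a `ℤʲ`-grading `𝒢` of
`Γ(Y, U)`, a Rees filtration `R'` on `Y`, an affine open `W'` of the cobordant blow-up `B₊ = R'.plus` and
a `ℤʲ⁺¹`-grading `𝒢'` of `Γ(B₊, W')`: `(W', 𝒢')` is a TOWER CHART over `(U, 𝒢)` — `W'` lies over `U`,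
and some ring isomorphism `e : Γ(B₊, W') ≃+* L` onto a localisation `L = (R'.sectionsRing U)[1/v₀]` of
the ring of sections `⊕ₙ 𝒥ₙ(U) tⁿ ⊆ Γ(Y, U)[t, t⁻¹]` (Włodarczyk's extended Rees algebra) matches `π₊♯`
with the structure map and `t⁻¹` with `t⁻¹`, and some `ℤʲ × ℤ`-grading `ℳ` of `L` has `t⁻¹` in degree
`(0, −1)`, the old degree-`χ` sections in degree `(χ, 0)` and `x tⁿ` in degree `(χ, n)` for `x ∈ 𝒥ₙ(U)`
of old degree `χ` (so `ℳ` is determined on ring generators of `L`: the torus `𝔾ₘʲ × 𝔾ₘ` of the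
cobordant blow-up), with `𝒢' = e⁻¹ ℳ` under `ℤʲ⁺¹ ≃ ℤʲ × ℤ`, `v ↦ (init v, v last)`. This is the shape
of the charts `D(β t^{Dg})` of the route's graded atlases (`DatumToEmbedded.AtlasAmbient.exists_ambientChart`,
Włodarczyk 2022 §2.3.3). A predicate of the line, not a cited statement. [cite: Wlodarczyk2022, §2.3.3] -/
structure TowerChartStep {Y : Scheme.{0}} (U : Y.affineOpens) (j : ℕ)
    (𝒢 : (Fin j → ℤ) → AddSubgroup Γ(Y, U)) (R' : ReesFiltration Y)
    (W' : (R'.plus : Scheme.{0}).affineOpens)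
    (𝒢' : (Fin (j + 1) → ℤ) → AddSubgroup Γ((R'.plus : Scheme.{0}), W')) : Prop where
  /-- the chart lies over `U` -/
  le_preimage : (W' : (R'.plus : Scheme.{0}).Opens) ≤ R'.πPlus ⁻¹ᵁ (U : Y.Opens)
  /-- the transport to a graded localisation of the extended Rees algebra -/
  exists_transport : ∃ (L : Type) (_ : CommRing L) (_ : Algebra (R'.sectionsRing U) L)
      (v₀ : R'.sectionsRing U) (_ : IsLocalization.Away v₀ L)
      (e : Γ((R'.plus : Scheme.{0}), W') ≃+* L)
      (ℳ : (Fin j → ℤ) × ℤ → Submodule ℤ L) (_ : GradedRing ℳ),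
      (∀ s : Γ(Y, U), e (R'.πPlus.appLE U W' le_preimage s) =
        algebraMap (R'.sectionsRing U) L (algebraMap Γ(Y, U) (R'.sectionsRing U) s)) ∧
      e (tInvOn R' W') = algebraMap (R'.sectionsRing U) L
        ⟨T (-1), (R'.filtration U).T_neg_one_mem_extendedRees⟩ ∧
      algebraMap (R'.sectionsRing U) L ⟨T (-1), (R'.filtration U).T_neg_one_mem_extendedRees⟩ ∈
        ℳ ((0 : Fin j → ℤ), (-1 : ℤ)) ∧
      (∀ (χ : Fin j → ℤ) (s : Γ(Y, U)), s ∈ 𝒢 χ →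
        algebraMap (R'.sectionsRing U) L (algebraMap Γ(Y, U) (R'.sectionsRing U) s) ∈ ℳ (χ, (0 : ℤ))) ∧
      (∀ (χ : Fin j → ℤ) (n : ℕ) (x : Γ(Y, U)) (hx : x ∈ (R'.ideal n).ideal U), x ∈ 𝒢 χ →
        algebraMap (R'.sectionsRing U) L
          ⟨C x * T (n : ℤ), (R'.filtration U).C_mul_T_mem_extendedRees_iff.mpr hx⟩ ∈ ℳ (χ, (n : ℤ))) ∧
      ∀ (v : Fin (j + 1) → ℤ) (y : Γ((R'.plus : Scheme.{0}), W')),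
        y ∈ 𝒢' v ↔ e y ∈ ℳ (Fin.init v, v (Fin.last j))

namespace HypersurfacePair

variable {k : Type} [Field k]

/-- **The successor pair along a cobordant blow-up**: the global cobordant blow-up `B₊ = R'.plus` of a
Rees filtration `R'` on the ambient of `P`, over `Spec k` through `P`, with the strict transform of the
hypersurface — given the facts (proved by the tower for the filtration of a regular weighted centre off
the generic point) that it is smooth separated quasi-compact and that the strict transform is a locally
principal ideal sheaf with integral subscheme. [folklore] -/
abbrev succ (P : HypersurfacePair k) (R' : ReesFiltration P.Y) (hs : Smooth (R'.πPlus ≫ P.f))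
    (hsep : IsSeparated (R'.πPlus ≫ P.f)) (hqc : QuasiCompact (R'.πPlus ≫ P.f))
    (hlp : IsLocallyPrincipal (R'.strictTransformPlus P.X))
    (hint : IsIntegral (R'.strictTransformPlus P.X).subscheme) : HypersurfacePair k :=
  @HypersurfacePair.mk k _ R'.plus (R'.πPlus ≫ P.f) hs hsep hqc (R'.strictTransformPlus P.X) hlp hint

/-- **Tower charts of a centre rule `c`.** `IsTowerChart c P j W 𝒢`: the affine open `W` of the
ambient of the hypersurface pair `P`, with the `ℤʲ`-grading `𝒢` of its sections, is a chart of the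
`𝔾ₘʲ`-torus of a cobordant tower of `c` ending at `P`: either `j = 0` and `𝒢` is the trivial grading
(every affine open of every pair — the towers START everywhere), or `P` is the successor (global
cobordant blow-up of the centre `c` of a singular pair `P⁻`, with the strict transform) and `(W, 𝒢)` is
a tower chart over a tower chart of `P⁻` (`TowerChartStep`). These are exactly the charts on which the
route's tower reads homogeneity of the centre. A predicate of the line, not a cited statement. [folklore] -/
inductive IsTowerChart (c : ∀ ⦃Y : Scheme.{0}⦄, (Y ⟶ Spec (.of k)) → Y.IdealSheafData → ReesAlgebraData Y) :
    ∀ (P : HypersurfacePair k) (j : ℕ) (W : P.Y.affineOpens),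
      ((Fin j → ℤ) → AddSubgroup Γ(P.Y, W)) → Prop
  /-- rank `0`: any affine open of any pair, with the trivial grading -/
  | start (P : HypersurfacePair k) (W : P.Y.affineOpens) (𝒢 : (Fin 0 → ℤ) → AddSubgroup Γ(P.Y, W))
      (h𝒢 : ∀ (v : Fin 0 → ℤ) (x : Γ(P.Y, W)), x ∈ 𝒢 v) : IsTowerChart c P 0 W 𝒢
  /-- rank `j + 1`: a tower chart of the cobordant blow-up of `c P` over a tower chart of `P` -/
  | step {P : HypersurfacePair k} {j : ℕ} {U : P.Y.affineOpens}
      {𝒢 : (Fin j → ℤ) → AddSubgroup Γ(P.Y, U)} (hU : IsTowerChart c P j U 𝒢)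
      (hsing : ¬ Scheme.IsRegular P.X.subscheme)
      (R' : ReesFiltration P.Y) (hR' : R'.ideal = (c P.f P.X).piece)
      (hs : Smooth (R'.πPlus ≫ P.f)) (hsep : IsSeparated (R'.πPlus ≫ P.f))
      (hqc : QuasiCompact (R'.πPlus ≫ P.f))
      (hlp : IsLocallyPrincipal (R'.strictTransformPlus P.X))
      (hint : IsIntegral (R'.strictTransformPlus P.X).subscheme)
      (W' : (R'.plus : Scheme.{0}).affineOpens)
      (𝒢' : (Fin (j + 1) → ℤ) → AddSubgroup Γ((R'.plus : Scheme.{0}), W'))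
      (hW' : TowerChartStep U j 𝒢 R' W' 𝒢') :
      IsTowerChart c (P.succ R' hs hsep hqc hlp hint) (j + 1) W' 𝒢'

/-- **Tower charts have the constants in degree `0`**: by induction along the tower — trivially at rank
`0`; one level up the constant `c₀` of `B₊` is `π₊♯` of the constant of `Y`, of old degree `0`, hence of
degree `(0, 0)`. [folklore] -/
theorem IsTowerChart.appLE_mem
    {c : ∀ ⦃Y : Scheme.{0}⦄, (Y ⟶ Spec (.of k)) → Y.IdealSheafData → ReesAlgebraData Y}
    {P : HypersurfacePair k} {j : ℕ} {W : P.Y.affineOpens}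
    {𝒢 : (Fin j → ℤ) → AddSubgroup Γ(P.Y, W)} (h : IsTowerChart c P j W 𝒢)
    (c₀ : Γ(Spec (.of k), ⊤)) : P.f.appLE ⊤ W le_top c₀ ∈ 𝒢 0 := by
  induction h with
  | start P W 𝒢 h𝒢 => exact h𝒢 0 _
  | step hU hsing R' hR' hs hsep hqc hlp hint W' 𝒢' hW' ih =>
    rename_i P j U 𝒢
    obtain ⟨L, _, _, v₀, _, e, ℳ, _, he₁, -, -, hdeg, -, hpiece⟩ := hW'.exists_transport
    have hc : (R'.πPlus ≫ P.f).appLE ⊤ W' le_top c₀ =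
        R'.πPlus.appLE U W' hW'.le_preimage (P.f.appLE ⊤ U le_top c₀) := by
      rw [← Scheme.Hom.appLE_comp_appLE R'.πPlus P.f ⊤ U W' le_top hW'.le_preimage]
      rfl
    change (R'.πPlus ≫ P.f).appLE ⊤ W' le_top c₀ ∈ 𝒢' 0
    rw [hpiece, hc, he₁]
    exact hdeg 0 _ ih

end HypersurfacePair

/-! ## The ladder with tower-typed homogeneity -/

/-- **Hypersurface centre choice in characteristic `p` and transversal dimension `e`, with TOWER-TYPED
homogeneity** (object posited by line `datum-glued-split` of crux `WeightedThesis`, RESHAPE 10): the ladder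
`HypersurfaceCentreChoiceDim p e` with the homogeneity obligation `(H)` (every grading of every affine
open) replaced by `(H_T)`: on a pair `P` reached in transversal dimension `e` whose hypersurface is not
regular, every piece of the centre is homogeneous on every TOWER CHART `(W, 𝒢)` of `P`
(`HypersurfacePair.IsTowerChart centre P j W 𝒢`: the charts of the `𝔾ₘʲ`-torus of the cobordant tower
that produced `P`, gradings pinned on ring generators) for which the hypersurface ideal is homogeneous.
This is exactly what the route's tower reads (its graded atlases consist of tower charts,
`Theorems/…HypersurfaceChoiceTAtlas.lean`), and it is what a torus-EQUIVARIANT construction provides: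
rung `e = 1` is the statement of Abramovich–Quek–Schober arXiv:2507.01232 Thm. 1.1 (hypersurface of a
regular `(n+2)`-fold with a `𝔾ₘⁿ`-action with finite stabilisers: the cobordant tower of the unique
`T`-invariant centres `(x₁^{a₁}, x₂^{a₂})` of maximal invariant along singular closed orbits terminates),
up to language. EVIDENCE, not a claim. -/
structure HypersurfaceCentreChoiceTDim (p e : ℕ) : Type 1 where
  /-- the weighted centre of `(Y, X)`, as a Rees algebra on `Y` (total) -/
  centre : ∀ ⦃k : Type⦄ [Field k] ⦃Y : Scheme.{0}⦄, (Y ⟶ Spec (.of k)) → Y.IdealSheafData →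
    ReesAlgebraData Y
  /-- `(iii)` [singular pairs reached in transversal dimension `e`] the centre is a regular weighted
  centre -/
  isRegularWeightedCentre_centre : ∀ ⦃k : Type⦄ [Field k] [CharP k p] [PerfectField k]
    (P : HypersurfacePair k),
    HypersurfacePair.ReachDim (fun ⦃Y : Scheme.{0}⦄ (f : Y ⟶ Spec (.of k)) X => centre f X) e P →
    ¬ Scheme.IsRegular P.X.subscheme → (centre P.f P.X).IsRegularWeightedCentre
  /-- `(ii')` [singular pairs reached in transversal dimension `e`, presented by a closed immersion `i`]
  the generic point of the hypersurface is off the centre -/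
  genericPoint_not_mem_support_centre : ∀ ⦃k : Type⦄ [Field k] [CharP k p] [PerfectField k]
    ⦃Y X : Scheme.{0}⦄ (f : Y ⟶ Spec (.of k)) [Smooth f] [IsSeparated f] [QuasiCompact f]
    (i : X ⟶ Y) [IsClosedImmersion i] [IsIntegral X] (hlp : IsLocallyPrincipal i.ker),
    HypersurfacePair.ReachDim (fun ⦃Y : Scheme.{0}⦄ (f : Y ⟶ Spec (.of k)) X => centre f X) e
      (HypersurfacePair.ofKer f i hlp) →
    ¬ Scheme.IsRegular X → i (genericPoint X) ∉ (centre f i.ker).support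
  /-- `(H_T)` [singular pairs reached in transversal dimension `e`] the centre is homogeneous on every
  TOWER chart of the pair for which the hypersurface ideal is homogeneous -/
  centre_isHomogeneous_towerChart : ∀ ⦃k : Type⦄ [Field k] [CharP k p] [PerfectField k]
    (P : HypersurfacePair k),
    HypersurfacePair.ReachDim (fun ⦃Y : Scheme.{0}⦄ (f : Y ⟶ Spec (.of k)) X => centre f X) e P →
    ¬ Scheme.IsRegular P.X.subscheme →
    ∀ ⦃j : ℕ⦄ (W : P.Y.affineOpens) (𝒢 : (Fin j → ℤ) → AddSubgroup Γ(P.Y, W)) [GradedRing 𝒢],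
    HypersurfacePair.IsTowerChart (fun ⦃Y : Scheme.{0}⦄ (f : Y ⟶ Spec (.of k)) X => centre f X)
      P j W 𝒢 →
    (P.X.ideal W).IsHomogeneous 𝒢 → ∀ n : ℕ, (((centre P.f P.X).piece n).ideal W).IsHomogeneous 𝒢
  /-- `(T)` over every perfect field of characteristic `p`, every cobordant tower started in dimension
  `e` stops -/
  wellFounded_step : ∀ ⦃k : Type⦄ [Field k] [CharP k p] [PerfectField k],
    WellFounded fun P' P : HypersurfacePair k =>
      HypersurfacePair.ReachDim (fun ⦃Y : Scheme.{0}⦄ (f : Y ⟶ Spec (.of k)) X => centre f X) e P ∧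
      HypersurfacePair.Step (fun ⦃Y : Scheme.{0}⦄ (f : Y ⟶ Spec (.of k)) X => centre f X) P' P

namespace HypersurfaceCentreChoiceTDim

variable {p e : ℕ}

/-- **`(H) ⇒ (H_T)`: every rung of the RESHAPE 9 ladder is a rung of the tower-typed ladder** (keep the
centre; a tower chart has the constants in degree `0`, `IsTowerChart.appLE_mem`, so `(H)` applies to it).
[folklore] -/
def ofChoiceDim (C : HypersurfaceCentreChoiceDim p e) : HypersurfaceCentreChoiceTDim p e where
  centre := C.centre
  isRegularWeightedCentre_centre := fun _ _ _ _ P hP hsing => C.isRegularWeightedCentre_centre P hP hsing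
  genericPoint_not_mem_support_centre := fun _ _ _ _ _ _ f _ _ _ i _ _ hlp hP hsing =>
    C.genericPoint_not_mem_support_centre f i hlp hP hsing
  centre_isHomogeneous_towerChart := fun _ _ _ _ P hP hsing _ W 𝒢 _ hW hXhom n =>
    C.centre_isHomogeneous P hP hsing W 𝒢 (fun c₀ => hW.appLE_mem c₀) hXhom n
  wellFounded_step := fun k _ _ _ => C.wellFounded_step (k := k)

/-- `ofChoiceDim` keeps the centre. [folklore] -/
@[simp] theorem ofChoiceDim_centre (C : HypersurfaceCentreChoiceDim p e) :
    (ofChoiceDim C).centre = C.centre := rfl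

/-- **RESHAPE 9's rung ⇒ RESHAPE 10's rung.** [folklore] -/
theorem nonempty_of_nonempty_choiceDim (h : Nonempty (HypersurfaceCentreChoiceDim p e)) :
    Nonempty (HypersurfaceCentreChoiceTDim p e) :=
  h.map ofChoiceDim

/-- **Choice ⇒ tower-typed rung** (choice ⇒ rung ⇒ tower-typed rung). [folklore] -/
theorem nonempty_of_nonempty_choice (h : Nonempty (HypersurfaceCentreChoice p)) (e : ℕ) :
    Nonempty (HypersurfaceCentreChoiceTDim p e) :=
  nonempty_of_nonempty_choiceDim (HypersurfaceCentreChoiceDim.nonempty_of_nonempty_choice h e)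

/-- **`WeightedConstruction` (stmt-0571) ⇒ tower-typed rung**, prime by prime. [folklore] -/
theorem nonempty_of_nonempty_datum (h : Nonempty (WeightedResolutionDatum p)) (e : ℕ) :
    Nonempty (HypersurfaceCentreChoiceTDim p e) :=
  nonempty_of_nonempty_choiceDim (HypersurfaceCentreChoiceDim.nonempty_of_nonempty_datum h e)

end HypersurfaceCentreChoiceTDim

end Summit.ResolutionOfSingularities.ResolutionOfSingularities.Theorems

end
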